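import Literature.RepresentationTheory.AlgebraicGroups.FirstFundamentalTheoremSLAllFields
import Literature.Computability.AlgebraicComplexity.MS2001ClassVarieties
import HarnessLib

/-!
# GCT I, Prop. 7.2 over EVERY algebraically closed field — `MS2001_prop_7_2` DISCHARGED

Theorem-only companion (no definitions, no named facts) of
`Literature/Computability/AlgebraicComplexity/MS2001ClassVarieties.lean` (K. D. Mulmuley, M. Sohoni,
*Geometric complexity theory I*, SIAM J. Comput. **31** (2001) 496–526 [MulmuleySohoniSIAM2001];
text of record = the authors' version (AV), `run/shared/lean/pub/val-lit/bip/texts/MS2001-authorversion/`)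
and of its `ℂ`-instance file `MS2001StabilizedFormsPlucker.lean` (`MS2001_prop_7_2_complex`, via the
Ω-process FFT, characteristic `0` only).

* **Prop. 7.2, first assertion** (AV p.31, all.txt L2331–2334): "Any form `h(X) ∈ [E(X)]` can be
  expressed as a homogeneous polynomial in the maximal minors of `X` (which correspond to Plücker
  coordinates)." Here `E(X) = ∏_σ det_σ(X)` is the form of the `m × km` variable matrix `X` (the tree's
  `msE F m k`), `K = stab(E(X)) ⊆ SL_n(F)`, `n = km²`, and `[E(X)]` = the degree-`d` forms
  (`d = m·k^m`) stabilised by `K` (`fixedForms (slSubgroup _ F) (msE F m k) (m * k ^ m)`). Printed proof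
  (AV p.31, L2336–2340): "Any form `h ∈ [E(X)]` is stabilized by the group `SL_m(F)` acting on `X` (by
  multiplication on the left); this follows from Proposition 7.1. It follows from classical invariant
  theory that `h(X)` is a polynomial in the `m × m` minors of `X`; this holds in arbitrary
  characteristic [8]" (`[8]` = De Concini–Procesi 1976).

This file follows the printed proof over an ARBITRARY field: (1) `X ↦ gX`, `g ∈ SL_m(F)`, is the linear
substitution by the block matrix `gᵀ ⊗ₖ 1` of determinant `1`, which fixes `E(X)` (every `det_σ` is
multiplied by `det g = 1`), so every `h ∈ [E(X)]` is invariant under it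
(`MS2001Prop72AllFields.linSubst_blockRow_eq_self_of_mem_fixedForms`); (2) after re-indexing the
columns `Fin m × Fin k ≃ Fin (m·k)` this is the left-multiplication invariance hypothesis of the tree's
CHARACTERISTIC-FREE first fundamental theorem
`Literature.RepresentationTheory.AlgebraicGroups.mem_adjoin_maximalMinor_of_forall_sl_invariant`
(`FirstFundamentalTheoremSLAllFields.lean`: Procesi, *Lie Groups*, Ch. 13 §5.5; De Concini–Procesi
1976), valid over every INFINITE field — whence `MS2001_prop_7_2_of_infinite`; (3) algebraically
closed fields are infinite, so the named fact `MS2001_prop_7_2` (all algebraically closed `F`, all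
characteristics, exactly as vendored) holds: `MS2001_prop_7_2_holds`. The degenerate case `k = 0 < m`
(`m ≰ m·k`: the matrix has no columns) is the degree-`0` case, where `h` is a constant.

Honest framing: a discharge BY NAME of a published invariant-theoretic statement about GCT I's
P-vs-NP form `E(X)` (val-lit row MS2001-A); it is not an obstruction and says nothing about the
conjectures of GCT I §7; neither VP ≠ VNP nor P ≠ NP is proved here or anywhere in the tree.

## References

* K. D. Mulmuley, M. Sohoni, *Geometric complexity theory I*, SIAM J. Comput. 31 (2001) 496–526,
  §7, Prop. 7.1, Prop. 7.2 (authors' version p.31). [MulmuleySohoniSIAM2001]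
* C. Procesi, *Lie Groups*, Universitext, Springer 2007, Ch. 13 §5.5 (FFT for `SL(n)`, characteristic
  free). [Procesi2007LieGroups]
* C. De Concini, C. Procesi, *A characteristic free approach to invariant theory*, Adv. Math. 21
  (1976) 330–354 (GCT I's reference [8]). [DeconciniProcesi1976]

## Tree

`msE`, `msMaximalMinor`, `fixedForms`, `mem_fixedForms_iff`, `slSubgroup`, `linSubst`, `linSubstRep`
(`Literature/Computability/AlgebraicComplexity`); `mem_adjoin_maximalMinor_of_forall_sl_invariant`
(`Literature/RepresentationTheory/AlgebraicGroups/FirstFundamentalTheoremSLAllFields.lean`). Standard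
axioms only.
-/

noncomputable section

namespace Literature.Computability.AlgebraicComplexity

open MvPolynomial
open scoped Kronecker
open Literature.RepresentationTheory.AlgebraicGroups

namespace MS2001Prop72AllFields

variable {F : Type*} [Field F] {m kk : ℕ}

/-- Entries of the block matrix of `X ↦ gX`: `(gᵀ ⊗ₖ 1)_{p q} = g_{q₁ p₁} · [p₂ = q₂]`. [folklore] -/
private theorem blockRow_apply (g : Matrix (Fin m) (Fin m) F) (p q : Fin m × (Fin m × Fin kk)) :
    (g.transpose ⊗ₖ (1 : Matrix (Fin m × Fin kk) (Fin m × Fin kk) F)) p q =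
      g q.1 p.1 * (if p.2 = q.2 then 1 else 0) := by
  obtain ⟨p₁, p₂⟩ := p
  obtain ⟨q₁, q₂⟩ := q
  simp [Matrix.transpose_apply, Matrix.one_apply]

/-- `det (gᵀ ⊗ₖ 1) = det(g)^{m·k}`. [folklore] -/
private theorem det_blockRow (g : Matrix (Fin m) (Fin m) F) :
    (g.transpose ⊗ₖ (1 : Matrix (Fin m × Fin kk) (Fin m × Fin kk) F)).det =
      g.det ^ Fintype.card (Fin m × Fin kk) := by
  rw [Matrix.det_kronecker, Matrix.det_transpose, Matrix.det_one, one_pow, mul_one]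

/-- The substitution by `gᵀ ⊗ₖ 1` on a variable: `x_{(r,c)} ↦ ∑_{r'} g_{r r'} • x_{(r',c)}`, the
`(r,c)` entry of `gX`. [folklore] -/
private theorem linSubst_blockRow_X (g : Matrix (Fin m) (Fin m) F) (q : Fin m × (Fin m × Fin kk)) :
    linSubst (Fin m × (Fin m × Fin kk)) F
        (g.transpose ⊗ₖ (1 : Matrix (Fin m × Fin kk) (Fin m × Fin kk) F)) (X q) =
      ∑ r' : Fin m, g q.1 r' • X (r', q.2) := by
  rw [linSubst_X, Fintype.sum_prod_type]
  refine Finset.sum_congr rfl fun r' _ => ?_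
  simp_rw [blockRow_apply]
  rw [Finset.sum_eq_single q.2]
  · simp
  · intro c _ hc
    simp [hc]
  · intro h
    exact absurd (Finset.mem_univ _) h

/-- Left multiplication multiplies every column-determinant by `det g`. [folklore] -/
private theorem linSubst_blockRow_det_of (g : Matrix (Fin m) (Fin m) F) (e : Fin m → Fin m × Fin kk) :
    linSubst (Fin m × (Fin m × Fin kk)) F
        (g.transpose ⊗ₖ (1 : Matrix (Fin m × Fin kk) (Fin m × Fin kk) F))
        (Matrix.of fun r c : Fin m => (X (r, e c) : MvPolynomial (Fin m × (Fin m × Fin kk)) F)).det =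
      C g.det *
        (Matrix.of fun r c : Fin m => (X (r, e c) : MvPolynomial (Fin m × (Fin m × Fin kk)) F)).det := by
  rw [AlgHom.map_det]
  have hmat : (linSubst (Fin m × (Fin m × Fin kk)) F
        (g.transpose ⊗ₖ (1 : Matrix (Fin m × Fin kk) (Fin m × Fin kk) F))).mapMatrix
      (Matrix.of fun r c : Fin m => (X (r, e c) : MvPolynomial (Fin m × (Fin m × Fin kk)) F)) =
      g.map C *
        Matrix.of fun r c : Fin m => (X (r, e c) : MvPolynomial (Fin m × (Fin m × Fin kk)) F) := by
    ext r c
    rw [AlgHom.mapMatrix_apply, Matrix.map_apply, Matrix.of_apply, linSubst_blockRow_X,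
      Matrix.mul_apply]
    simp only [Matrix.map_apply, Matrix.of_apply, smul_eq_C_mul]
  rw [hmat, Matrix.det_mul]
  congr 1
  exact (RingHom.map_det (C : F →+* MvPolynomial (Fin m × (Fin m × Fin kk)) F) g).symm

/-- **`X ↦ gX`, `g ∈ SL_m`, fixes `E(X)`** (each factor `det_σ(gX) = det g · det_σ(X) = det_σ(X)`;
Prop. 7.1's `S ≅ SL_m(F) ⊆ K`), over any field.
[cite: MulmuleySohoniSIAM2001, Prop. 7.1 and proof of Prop. 7.2 (AV p.31, all.txt L2262, L2336)] -/
private theorem linSubst_blockRow_msE (g : Matrix (Fin m) (Fin m) F) (hg : g.det = 1) :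
    linSubst (Fin m × (Fin m × Fin kk)) F
        (g.transpose ⊗ₖ (1 : Matrix (Fin m × Fin kk) (Fin m × Fin kk) F)) (msE F m kk) =
      msE F m kk := by
  unfold msE
  rw [map_prod]
  refine Finset.prod_congr rfl fun σ _ => ?_
  rw [linSubst_blockRow_det_of, hg, map_one, one_mul]

/-- The block matrix of `g ∈ SL_m(F)` is an element of `SL_n(F)`, `n = km²`. [folklore] -/
private theorem exists_slSubgroup_coe_eq_blockRow (g : Matrix.SpecialLinearGroup (Fin m) F) :
    ∃ γ ∈ slSubgroup (Fin m × (Fin m × Fin kk)) F,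
      ((γ : GL (Fin m × (Fin m × Fin kk)) F) : Matrix _ _ F) =
        (g : Matrix (Fin m) (Fin m) F).transpose ⊗ₖ (1 : Matrix (Fin m × Fin kk) (Fin m × Fin kk) F) :=
  ⟨Matrix.SpecialLinearGroup.toGL
      ⟨(g : Matrix (Fin m) (Fin m) F).transpose ⊗ₖ (1 : Matrix (Fin m × Fin kk) (Fin m × Fin kk) F),
        by rw [det_blockRow, g.det_coe, one_pow]⟩,
    ⟨_, rfl⟩, rfl⟩

/-- **Every `h ∈ [E(X)]` is invariant under `X ↦ gX`, `g ∈ SL_m(F)`** ("Any form `h ∈ [E(X)]` is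
stabilized by the group `SL_m(F)` acting on `X` (by multiplication on the left)", AV p.31), over
any field. [cite: MulmuleySohoniSIAM2001, proof of Prop. 7.2 (AV p.31, all.txt L2336)] -/
private theorem linSubst_blockRow_eq_self_of_mem_fixedForms {d : ℕ}
    {h : MvPolynomial (Fin m × (Fin m × Fin kk)) F}
    (hh : h ∈ fixedForms (slSubgroup (Fin m × (Fin m × Fin kk)) F) (msE F m kk) d)
    (g : Matrix.SpecialLinearGroup (Fin m) F) :
    linSubst (Fin m × (Fin m × Fin kk)) F
        ((g : Matrix (Fin m) (Fin m) F).transpose ⊗ₖ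
          (1 : Matrix (Fin m × Fin kk) (Fin m × Fin kk) F)) h = h := by
  obtain ⟨γ, hγ, hcoe⟩ := exists_slSubgroup_coe_eq_blockRow (kk := kk) g
  have hstab : linSubstRep _ F γ (msE F m kk) = msE F m kk := by
    rw [linSubstRep_apply, hcoe]
    exact linSubst_blockRow_msE _ g.det_coe
  have := (mem_fixedForms_iff.mp hh).2 γ hγ hstab
  rwa [linSubstRep_apply, hcoe] at this

/-- **Transport of the action**: after re-indexing the columns by `Fin m × Fin k ≃ Fin (m·k)`, the
substitution `X ↦ gX` is the left-multiplication substitution `x_{ij} ↦ ∑_k g_{ik} x_{kj}` of the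
first fundamental theorem. [folklore] -/
private theorem rename_linSubst_blockRow (g : Matrix (Fin m) (Fin m) F)
    (h : MvPolynomial (Fin m × (Fin m × Fin kk)) F) :
    rename (Equiv.prodCongr (Equiv.refl (Fin m)) finProdFinEquiv)
        (linSubst (Fin m × (Fin m × Fin kk)) F
          (g.transpose ⊗ₖ (1 : Matrix (Fin m × Fin kk) (Fin m × Fin kk) F)) h) =
      aeval (fun p : Fin m × Fin (m * kk) =>
          ∑ k : Fin m, C (g p.1 k) * (X (k, p.2) : MvPolynomial (Fin m × Fin (m * kk)) F))
        (rename (Equiv.prodCongr (Equiv.refl (Fin m)) finProdFinEquiv) h) := by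
  have key : (rename (Equiv.prodCongr (Equiv.refl (Fin m)) finProdFinEquiv)).comp
        (linSubst (Fin m × (Fin m × Fin kk)) F
          (g.transpose ⊗ₖ (1 : Matrix (Fin m × Fin kk) (Fin m × Fin kk) F))) =
      (aeval (fun p : Fin m × Fin (m * kk) =>
          ∑ k : Fin m, C (g p.1 k) * (X (k, p.2) : MvPolynomial (Fin m × Fin (m * kk)) F))).comp
        (rename (Equiv.prodCongr (Equiv.refl (Fin m)) finProdFinEquiv)) := by
    refine MvPolynomial.algHom_ext fun q => ?_
    rw [AlgHom.comp_apply, AlgHom.comp_apply, linSubst_blockRow_X, map_sum, rename_X, aeval_X,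
      Equiv.prodCongr_apply, Equiv.coe_refl, Prod.map_fst, Prod.map_snd]
    refine Finset.sum_congr rfl fun r' _ => ?_
    rw [map_smul, rename_X, smul_eq_C_mul]
    rfl
  exact congrArg (fun φ : MvPolynomial (Fin m × (Fin m × Fin kk)) F →ₐ[F]
      MvPolynomial (Fin m × Fin (m * kk)) F => φ h) key

/-- **Un-indexing a maximal minor gives a maximal minor of `X`** in the §7 coordinates. [folklore] -/
private theorem rename_symm_det (c : Fin m → Fin (m * kk)) :
    rename (Equiv.prodCongr (Equiv.refl (Fin m)) finProdFinEquiv).symm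
        ((Matrix.of fun i k : Fin m => (X (i, c k) : MvPolynomial (Fin m × Fin (m * kk)) F)).det) =
      msMaximalMinor F m kk (fun i => finProdFinEquiv.symm (c i)) := by
  unfold msMaximalMinor
  rw [AlgHom.map_det]
  congr 1
  ext r i
  simp only [AlgHom.mapMatrix_apply, Matrix.map_apply, Matrix.of_apply, rename_X,
    Equiv.prodCongr_symm, Equiv.prodCongr_apply, Equiv.refl_symm, Equiv.coe_refl, Prod.map_apply,
    id_eq]

end MS2001Prop72AllFields

open MS2001Prop72AllFields in
/-- **GCT I, Prop. 7.2 (first assertion) over every infinite field.** "Any form `h(X) ∈ [E(X)]`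
can be expressed as a homogeneous polynomial in the maximal minors of `X` (which correspond to
Plücker coordinates)" (AV p.31, all.txt L2331–2334; printed proof: `h` is invariant under `X ↦ gX`,
`g ∈ SL_m(F)` — Prop. 7.1 — then "classical invariant theory … in arbitrary characteristic [8]" =
De Concini–Procesi): in the tree's rendering, every
`h ∈ fixedForms (slSubgroup _ F) (msE F m k) (m * k ^ m)` lies in
`Algebra.adjoin F (range (msMaximalMinor F m k))`. The invariant theory is the tree's characteristic-free
first fundamental theorem `mem_adjoin_maximalMinor_of_forall_sl_invariant`
(`FirstFundamentalTheoremSLAllFields.lean`). The degenerate case `k = 0 < m` (no columns) is the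
degree-`0` case: `h` is a constant. [cite: MulmuleySohoniSIAM2001, Prop. 7.2 (AV p.31, all.txt L2331)]
[cite: Procesi2007LieGroups, Ch. 13 §5.5, Theorem "SL(n) Invariants"] -/
theorem MS2001_prop_7_2_of_infinite (F : Type) [Field F] [Infinite F] (m kk : ℕ) :
    ∀ h ∈ fixedForms (slSubgroup (Fin m × (Fin m × Fin kk)) F) (msE F m kk) (m * kk ^ m),
      h ∈ Algebra.adjoin F (Set.range (msMaximalMinor F m kk)) := by
  classical
  intro h hh
  have hhom : h.IsHomogeneous (m * kk ^ m) := (mem_fixedForms_iff.mp hh).1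
  by_cases hmk : m ≤ m * kk
  · -- the re-indexed form is an `SL_m`-invariant, hence a bracket polynomial (FFT)
    have hmem : rename (Equiv.prodCongr (Equiv.refl (Fin m)) finProdFinEquiv) h ∈
        Algebra.adjoin F (Set.range fun c : Fin m → Fin (m * kk) =>
          (Matrix.of fun i k : Fin m => (X (i, c k) : MvPolynomial (Fin m × Fin (m * kk)) F)).det) := by
      refine mem_adjoin_maximalMinor_of_forall_sl_invariant hmk hhom.rename_isHomogeneous ?_
      intro g
      rw [← rename_linSubst_blockRow, linSubst_blockRow_eq_self_of_mem_fixedForms hh g]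
    have hback : rename (Equiv.prodCongr (Equiv.refl (Fin m)) finProdFinEquiv).symm
        (rename (Equiv.prodCongr (Equiv.refl (Fin m)) finProdFinEquiv) h) = h := by
      rw [rename_rename, Equiv.symm_comp_self, rename_id, AlgHom.id_apply]
    rw [← hback]
    have himg : rename (Equiv.prodCongr (Equiv.refl (Fin m)) finProdFinEquiv).symm
          (rename (Equiv.prodCongr (Equiv.refl (Fin m)) finProdFinEquiv) h) ∈
        (Algebra.adjoin F (Set.range fun c : Fin m → Fin (m * kk) =>
          (Matrix.of fun i k : Fin m => (X (i, c k) : MvPolynomial (Fin m × Fin (m * kk)) F)).det)).map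
          (rename (Equiv.prodCongr (Equiv.refl (Fin m)) finProdFinEquiv).symm :
            MvPolynomial (Fin m × Fin (m * kk)) F →ₐ[F] MvPolynomial (Fin m × (Fin m × Fin kk)) F) :=
      Subalgebra.mem_map.mpr ⟨_, hmem, rfl⟩
    rw [AlgHom.map_adjoin] at himg
    refine Algebra.adjoin_mono ?_ himg
    rintro _ ⟨_, ⟨c, rfl⟩, rfl⟩
    exact ⟨fun i => finProdFinEquiv.symm (c i), (rename_symm_det c).symm⟩
  · -- `k = 0 < m`: the degree is `0`, so `h` is a constant
    have hkk : kk = 0 := by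
      by_contra hne
      exact hmk (Nat.le_mul_of_pos_right m (Nat.pos_of_ne_zero hne))
    have hm : 0 < m := by
      by_contra hle
      push Not at hle
      interval_cases m
      exact hmk (Nat.zero_le _)
    have hdeg : m * kk ^ m = 0 := by
      rw [hkk, zero_pow (Nat.pos_iff_ne_zero.mp hm), mul_zero]
    rw [hdeg] at hhom
    have hC : h = C (coeff 0 h) := by
      rw [← totalDegree_eq_zero_iff_eq_C]
      exact Nat.le_zero.mp hhom.totalDegree_le
    rw [hC]
    exact Subalgebra.algebraMap_mem _ _

/-- **GCT I, Prop. 7.2 (first assertion) DISCHARGED** over every algebraically closed field `F` of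
arbitrary characteristic, exactly as vendored in `MS2001ClassVarieties.lean`: the named fact
`MS2001_prop_7_2` holds. (Algebraically closed fields are infinite; the statement holds over every
infinite field, `MS2001_prop_7_2_of_infinite`.) Honest framing: a bookkeeping discharge of a
published invariant-theoretic statement about GCT I's form `E(X)`; nothing here bears on
VP versus VNP or P versus NP. [cite: MulmuleySohoniSIAM2001, Prop. 7.2 (AV p.31, all.txt L2331)] -/
theorem MS2001_prop_7_2_holds : MS2001_prop_7_2 := by
  intro F _ _ m kk
  exact MS2001_prop_7_2_of_infinite F m kk

end Literature.Computability.AlgebraicComplexity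

end
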